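/-
Copyright: H21 programme, solo seat `solo-RiemannHypothesis-informed` (session 6).
-/
import Summits.RiemannHypothesis.RiemannHypothesis.Theorems.SoloInformedCombWeight
import Summits.RiemannHypothesis.RiemannHypothesis.Theorems.SoloInformedMultiPair

/-!
# The bilinear comb test (solo-informed, T39f)

The test function behind the price-of-a-companion theorem:

`g(t) = (φ_J(t - t_A) + c · φ_J(t - s_B)) · e^{-iγ₀ t}`   (`combPair J c t_A s_B γ₀`),

two translates of the comb bump `φ_J = combTest J` with a free phase `c` and free
separation `τ = t_A - s_B`.  With `λ = ρ - ½ - iγ₀` and `Φ_J = combXform J`: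

* `ĝ(ρ) = Φ_J(λ) (e^{λ t_A} + c e^{λ s_B})` (`weilMellin_combPair`);
* the **net pair identity** `ĝ(ρ) · conj ĝ(1-ρ̄) = Φ_J(λ)² ((1+|c|²) + c̄ e^{λτ} + c e^{-λτ})`
  (`weilMellin_combPair_mul_conj`), using `Φ_J(-λ̄) = conj Φ_J(λ)`;
* `|ĝ(ρ)|² ≤ 4 e^{2|Re λ|(a-1)} |Φ_J(λ)|²` for `|c| ≤ 1`, `|t_A|, |s_B| ≤ a - 1`
  (`norm_sq_weilMellin_combPair_le`);
* `g` is a Weil test function supported in `[-a, a]` with `‖g‖₂ > 0` once `|τ| ≥ 1`.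
-/

noncomputable section

open Real MeasureTheory Filter Complex Set Literature.NumberTheory.LFunctions
open scoped Topology ContDiff ComplexConjugate

namespace Summit.RiemannHypothesis.RiemannHypothesis.Theorems

open Companion

namespace Companion

/-- `φ_J(u) = 0` for `|u| ≥ 1`. -/
theorem combTest_eq_zero (J : ℕ) {u : ℝ} (hu : 1 ≤ |u|) : combTest J u = 0 := by
  simp [combTest, combBump, windowPlateau_eq_zero hu]

/-- A continuous compactly supported function that does not vanish identically has positive
`L²` norm. -/
theorem integral_norm_sq_pos_of_ne_zero {g : ℝ → ℂ} (hg : IsWeilTest g) {t₀ : ℝ}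
    (h0 : g t₀ ≠ 0) : 0 < ∫ t, ‖g t‖ ^ 2 := by
  have hgc : Continuous g := hg.1.continuous
  have hcont : Continuous fun t ↦ ‖g t‖ ^ 2 := by fun_prop
  have hint : Integrable fun t ↦ ‖g t‖ ^ 2 :=
    hcont.integrable_of_hasCompactSupport (hg.2.norm.comp_left (g := fun x : ℝ ↦ x ^ 2) (by simp))
  have hnn : 0 ≤ ∫ t, ‖g t‖ ^ 2 := integral_nonneg fun t ↦ by positivity
  rcases hnn.lt_or_eq with hlt | heq
  · exact hlt
  exfalso
  have hae : (fun t ↦ ‖g t‖ ^ 2) =ᵐ[volume] 0 :=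
    (integral_eq_zero_iff_of_nonneg (fun t ↦ by positivity) hint).mp heq.symm
  have hfun : (fun t ↦ ‖g t‖ ^ 2) = fun _ ↦ (0 : ℝ) :=
    (Continuous.ae_eq_iff_eq volume hcont continuous_const).mp hae
  have := congrFun hfun t₀
  simp only [ne_eq, OfNat.ofNat_ne_zero, not_false_eq_true, pow_eq_zero_iff, norm_eq_zero] at this
  exact h0 this

end Companion

variable {J : ℕ} {c : ℂ} {tA sB γ₀ : ℝ}

/-- The two-bump profile `h(t) = φ_J(t - t_A) + c · φ_J(t - s_B)`. -/
def combPairProfile (J : ℕ) (c : ℂ) (tA sB : ℝ) : ℝ → ℂ :=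
  weilTranslate (combTest J) tA + fun t ↦ c * weilTranslate (combTest J) sB t

/-- The bilinear comb test `g(t) = (φ_J(t - t_A) + c φ_J(t - s_B)) e^{-iγ₀ t}`. -/
def combPair (J : ℕ) (c : ℂ) (tA sB γ₀ : ℝ) : ℝ → ℂ :=
  fun t ↦ combPairProfile J c tA sB t * cexp (-(γ₀ * I) * t)

/-- Pointwise formula for the profile. -/
theorem combPairProfile_apply (t : ℝ) :
    combPairProfile J c tA sB t = combTest J (t - tA) + c * combTest J (t - sB) := rfl

/-- The profile is a Weil test function. -/
theorem isWeilTest_combPairProfile : IsWeilTest (combPairProfile J c tA sB) :=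
  ((isWeilTest_combTest J).weilTranslate tA).add
    (((isWeilTest_combTest J).weilTranslate sB).const_mul c)

/-- The bilinear comb test is a Weil test function. -/
theorem isWeilTest_combPair : IsWeilTest (combPair J c tA sB γ₀) :=
  isWeilTest_mul_cexp isWeilTest_combPairProfile _

/-- The profile vanishes at distance `≥ 1` from both centres. -/
theorem combPairProfile_eq_zero {t : ℝ} (hA : 1 ≤ |t - tA|) (hB : 1 ≤ |t - sB|) :
    combPairProfile J c tA sB t = 0 := by
  rw [combPairProfile_apply, combTest_eq_zero J hA, combTest_eq_zero J hB, mul_zero, add_zero]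

/-- Support: if `|t_A|, |s_B| ≤ a - 1` then `supp g ⊆ [-a, a]`. -/
theorem tsupport_combPair_subset {a : ℝ} (htA : |tA| ≤ a - 1) (hsB : |sB| ≤ a - 1) :
    tsupport (combPair J c tA sB γ₀) ⊆ Icc (-a) a := by
  refine closure_minimal (fun t ht ↦ ?_) isClosed_Icc
  rw [Function.mem_support] at ht
  by_contra hout
  apply ht
  have hta : a < |t| := by
    rcases not_and_or.mp hout with h | h
    · exact lt_abs.mpr (Or.inr (by linarith))
    · exact lt_abs.mpr (Or.inl (by linarith))
  unfold combPair
  rw [combPairProfile_eq_zero, zero_mul]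
  · linarith [abs_sub_abs_le_abs_sub t tA]
  · linarith [abs_sub_abs_le_abs_sub t sB]

/-- `‖g‖₂ > 0` as soon as the two bumps do not meet at `t_A`: `|t_A - s_B| ≥ 1`. -/
theorem integral_norm_sq_combPair_pos (hτ : 1 ≤ |tA - sB|) :
    0 < ∫ t, ‖combPair J c tA sB γ₀ t‖ ^ 2 := by
  refine integral_norm_sq_pos_of_ne_zero isWeilTest_combPair (t₀ := tA) ?_
  unfold combPair
  rw [combPairProfile_apply, sub_self, combTest_zero, combTest_eq_zero J hτ, mul_zero, add_zero]
  refine mul_ne_zero ?_ (Complex.exp_ne_zero _)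
  exact_mod_cast (show (2 * J + 1 : ℕ) ≠ 0 by omega)

/-! ## The transform -/

/-- `φ̂_J(s) = Φ_J(s - ½)`. -/
theorem weilMellin_combTest (J : ℕ) (s : ℂ) :
    weilMellin (combTest J) s = combXform J (s - 1 / 2) := by
  rw [combXform_eq_weilMellin, sub_add_cancel]

/-- `ĥ(s) = Φ_J(s - ½) (e^{(s-½) t_A} + c e^{(s-½) s_B})`. -/
theorem weilMellin_combPairProfile (s : ℂ) :
    weilMellin (combPairProfile J c tA sB) s =
      combXform J (s - 1 / 2) * (cexp ((s - 1 / 2) * tA) + c * cexp ((s - 1 / 2) * sB)) := by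
  have hA := (isWeilTest_combTest J).weilTranslate tA
  have hB := ((isWeilTest_combTest J).weilTranslate sB).const_mul c
  unfold combPairProfile
  rw [weilMellin_add hA.1.continuous hA.2 hB.1.continuous hB.2,
    Literature.NumberTheory.LFunctions.weilMellin_const_mul, weilMellin_weilTranslate,
    weilMellin_weilTranslate, weilMellin_combTest]
  ring

/-- **Transform of the bilinear comb test**: `ĝ(ρ) = Φ_J(λ)(e^{λ t_A} + c e^{λ s_B})`,
`λ = ρ - ½ - iγ₀`. -/
theorem weilMellin_combPair (ρ : ℂ) :
    weilMellin (combPair J c tA sB γ₀) ρ =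
      combXform J (ρ - 1 / 2 - γ₀ * I) *
        (cexp ((ρ - 1 / 2 - γ₀ * I) * tA) + c * cexp ((ρ - 1 / 2 - γ₀ * I) * sB)) := by
  unfold combPair
  rw [weilMellin_mul_cexp, weilMellin_combPairProfile,
    show ρ + -(γ₀ * I) - 1 / 2 = ρ - 1 / 2 - γ₀ * I by ring]

/-- The reflected point: `(1 - ρ̄) - ½ - iγ₀ = -conj(ρ - ½ - iγ₀)`. -/
theorem one_sub_conj_shift (ρ : ℂ) (γ₀ : ℝ) :
    (1 - conj ρ - 1 / 2 - γ₀ * I : ℂ) = -conj (ρ - 1 / 2 - γ₀ * I) := by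
  simp only [map_sub, map_mul, map_div₀, map_one, map_ofNat, Complex.conj_ofReal, Complex.conj_I]
  ring

/-- `ĝ(1 - ρ̄) = conj Φ_J(λ) · (e^{-λ̄ t_A} + c e^{-λ̄ s_B})`. -/
theorem weilMellin_combPair_reflect (ρ : ℂ) :
    weilMellin (combPair J c tA sB γ₀) (1 - conj ρ) =
      conj (combXform J (ρ - 1 / 2 - γ₀ * I)) *
        (cexp (-conj (ρ - 1 / 2 - γ₀ * I) * tA) + c * cexp (-conj (ρ - 1 / 2 - γ₀ * I) * sB)) := by
  rw [weilMellin_combPair, one_sub_conj_shift, combXform_neg, combXform_conj]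

/-- **Net pair identity (T39f)**: with `λ = ρ - ½ - iγ₀` and `τ = t_A - s_B`,
`ĝ(ρ) · conj ĝ(1 - ρ̄) = Φ_J(λ)² ((1 + |c|²) + c̄ e^{λτ} + c e^{-λτ})`. -/
theorem weilMellin_combPair_mul_conj (ρ : ℂ) :
    weilMellin (combPair J c tA sB γ₀) ρ * conj (weilMellin (combPair J c tA sB γ₀) (1 - conj ρ)) =
      combXform J (ρ - 1 / 2 - γ₀ * I) ^ 2 *
        (((1 + ‖c‖ ^ 2 : ℝ) : ℂ) + conj c * cexp ((ρ - 1 / 2 - γ₀ * I) * (tA - sB)) +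
          c * cexp (-((ρ - 1 / 2 - γ₀ * I) * (tA - sB)))) := by
  rw [weilMellin_combPair_reflect, weilMellin_combPair]
  set μ : ℂ := ρ - 1 / 2 - γ₀ * I
  have hcc : (((1 + ‖c‖ ^ 2 : ℝ)) : ℂ) = 1 + c * conj c := by
    rw [Complex.mul_conj, Complex.normSq_eq_norm_sq]; push_cast; ring
  simp only [map_mul, map_add, Complex.conj_conj, ← Complex.exp_conj, map_neg, Complex.conj_ofReal]
  rw [hcc]
  have e1 : cexp (-μ * tA) = (cexp (μ * tA))⁻¹ := by rw [← Complex.exp_neg]; ring_nf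
  have e2 : cexp (-μ * sB) = (cexp (μ * sB))⁻¹ := by rw [← Complex.exp_neg]; ring_nf
  have e3 : cexp (μ * (tA - sB)) = cexp (μ * tA) * (cexp (μ * sB))⁻¹ := by
    rw [← Complex.exp_neg, ← Complex.exp_add]; ring_nf
  have e4 : cexp (-(μ * (tA - sB))) = cexp (μ * sB) * (cexp (μ * tA))⁻¹ := by
    rw [← Complex.exp_neg, ← Complex.exp_add]; ring_nf
  rw [e1, e2, e3, e4]
  have hA : cexp (μ * tA) ≠ 0 := Complex.exp_ne_zero _
  have hB : cexp (μ * sB) ≠ 0 := Complex.exp_ne_zero _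
  field_simp
  ring

/-! ## Size of the transform -/

/-- `‖e^{λ x}‖ ≤ e^{|Re λ| b}` for `|x| ≤ b`. -/
theorem norm_cexp_mul_ofReal_le (μ : ℂ) {x b : ℝ} (hx : |x| ≤ b) :
    ‖cexp (μ * x)‖ ≤ Real.exp (|μ.re| * b) := by
  rw [Complex.norm_exp, Real.exp_le_exp]
  have : (μ * x).re = μ.re * x := by simp [Complex.mul_re]
  rw [this]
  calc μ.re * x ≤ |μ.re * x| := le_abs_self _
    _ = |μ.re| * |x| := abs_mul _ _
    _ ≤ |μ.re| * b := mul_le_mul_of_nonneg_left hx (abs_nonneg _)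

/-- **Majorant of the transform (T39f)**: for `|c| ≤ 1` and `|t_A|, |s_B| ≤ a - 1`,
`‖ĝ(ρ)‖² ≤ 4 e^{2|Re λ|(a-1)} ‖Φ_J(λ)‖²`. -/
theorem norm_sq_weilMellin_combPair_le (hc : ‖c‖ ≤ 1) {a : ℝ} (htA : |tA| ≤ a - 1)
    (hsB : |sB| ≤ a - 1) (ρ : ℂ) :
    ‖weilMellin (combPair J c tA sB γ₀) ρ‖ ^ 2 ≤
      4 * Real.exp (2 * (|(ρ - 1 / 2 - γ₀ * I).re| * (a - 1))) *
        ‖combXform J (ρ - 1 / 2 - γ₀ * I)‖ ^ 2 := by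
  set μ : ℂ := ρ - 1 / 2 - γ₀ * I
  rw [weilMellin_combPair, norm_mul]
  have hE := Real.exp_pos (|μ.re| * (a - 1))
  have h1 := norm_cexp_mul_ofReal_le μ htA
  have h2 := norm_cexp_mul_ofReal_le μ hsB
  have hsum : ‖cexp (μ * tA) + c * cexp (μ * sB)‖ ≤ 2 * Real.exp (|μ.re| * (a - 1)) := by
    refine (norm_add_le _ _).trans ?_
    rw [norm_mul]
    nlinarith [norm_nonneg c, norm_nonneg (cexp (μ * sB))]
  have h0 : 0 ≤ ‖cexp (μ * tA) + c * cexp (μ * sB)‖ := norm_nonneg _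
  calc (‖combXform J μ‖ * ‖cexp (μ * tA) + c * cexp (μ * sB)‖) ^ 2
      = ‖combXform J μ‖ ^ 2 * ‖cexp (μ * tA) + c * cexp (μ * sB)‖ ^ 2 := by ring
    _ ≤ ‖combXform J μ‖ ^ 2 * (2 * Real.exp (|μ.re| * (a - 1))) ^ 2 := by
        gcongr
    _ = 4 * Real.exp (2 * (|μ.re| * (a - 1))) * ‖combXform J μ‖ ^ 2 := by
        rw [mul_pow, ← Real.exp_nat_mul]; push_cast; ring

/-- On the critical line the exponential factor is `1`: `‖ĝ(ρ)‖² ≤ 4‖Φ_J(λ)‖²`. -/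
theorem norm_sq_weilMellin_combPair_le_critical (hc : ‖c‖ ≤ 1) {a : ℝ} (htA : |tA| ≤ a - 1)
    (hsB : |sB| ≤ a - 1) {ρ : ℂ} (hre : ρ.re = 1 / 2) :
    ‖weilMellin (combPair J c tA sB γ₀) ρ‖ ^ 2 ≤ 4 * ‖combXform J (ρ - 1 / 2 - γ₀ * I)‖ ^ 2 := by
  have h := norm_sq_weilMellin_combPair_le (J := J) (γ₀ := γ₀) hc htA hsB ρ
  have hre' : (ρ - 1 / 2 - γ₀ * I).re = 0 := by simp [hre]
  rwa [hre', abs_zero, zero_mul, mul_zero, Real.exp_zero, mul_one] at h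

/-- In the strip `0 ≤ Re ρ ≤ 1` the exponential factor is `≤ e^{a-1}`:
`‖ĝ(ρ)‖² ≤ 4 e^{a-1} ‖Φ_J(λ)‖²` (for `a ≥ 1`). -/
theorem norm_sq_weilMellin_combPair_le_strip (hc : ‖c‖ ≤ 1) {a : ℝ} (ha : 1 ≤ a)
    (htA : |tA| ≤ a - 1) (hsB : |sB| ≤ a - 1) {ρ : ℂ} (h0 : 0 ≤ ρ.re) (h1 : ρ.re ≤ 1) :
    ‖weilMellin (combPair J c tA sB γ₀) ρ‖ ^ 2 ≤
      4 * Real.exp (a - 1) * ‖combXform J (ρ - 1 / 2 - γ₀ * I)‖ ^ 2 := by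
  have h := norm_sq_weilMellin_combPair_le (J := J) (γ₀ := γ₀) hc htA hsB ρ
  refine h.trans ?_
  have hre' : (ρ - 1 / 2 - γ₀ * I).re = ρ.re - 1 / 2 := by simp
  have hx : |(ρ - 1 / 2 - γ₀ * I).re| ≤ 1 / 2 := by rw [hre', abs_le]; constructor <;> linarith
  gcongr
  nlinarith

end Summit.RiemannHypothesis.RiemannHypothesis.Theorems
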